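import Mathlib
import Literature.NumberTheory.ModularForms.SturmCongruenceBoundProofs
import Summits.Langlands.Langlands.Theorems.CapacityClassicalityHilbertIntegralOverconvergentIsCongruenceShadow

/-!
# Crux `HilbertIntegralOverconvergentIsCongruence` (stmt-Langlands-8485), line `Sketch-ideate-r1-k1`:
# the `d = 1` Sturm–Schwarz `p`-adic lemma at the cusp, UNCONDITIONAL at every level

The line's registered endpoint `SketchIdeateR1K1.SturmSchwarzShadowCuspQ` (skeleton
`Cruxes/HilbertIntegralOverconvergentIsCongruence/Lines/Sketch_ideate_r1_k1.lean`) was landed in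
`…Shadow.lean` conditional on ONE named fact, Sturm's congruence bound mod `p` for cusp forms on
`Γ₁(N)` (`sturmSchwarzShadowCusp_of_Sturm1987`, `sturmSchwarzShadowCusp_of_sturmModPrime_at`).  That
fact is now a THEOREM of the tree:
`Literature.NumberTheory.ModularForms.Sturm1987_congruenceBound_Gamma1_modPrime_holds`
(`Literature/NumberTheory/ModularForms/SturmCongruenceBoundProofs.lean`, the Sturm–Murty norm argument
on the Deligne–Serre integral span).  This file discharges the line's registered stub 1′ by that theorem
and records the resulting unconditional statement:

* `stub_sturmModPrime` — registered stub 1′ (Sturm mod `p` for `S_k(Γ₁(N))`), now `:= …_holds`;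
* `sturmSchwarzShadowCusp` — for `p ≥ 5` prime, `p ∤ N`, every Katz surrogate
  `g_n = Σ_i ι⁻¹ coeff_n (c_i · E_{p-1}^{-i})` on `Γ₁(N)` of rate `r` and constant `C` (`c_i` the
  `q`-expansion of a classical form of weight `k + i(p-1)` on `Γ₁(N)`, `‖ι⁻¹ c_i‖ ≤ C p^{-ri}`) whose
  `q`-expansion vanishes to order `m` satisfies `‖g_m‖ ≤ C · p^{-r(M+1)}` for every `M` with
  `⌊(12 + k + M(p-1)) · [SL₂(ℤ):Γ₁(N)] / 12⌋ ≤ m` — the `p`-adic Schwarz lemma at the cusp that the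
  Hilbert engine's lever (`KatzSturmLeverAbstract`) specialises to in dimension `d = 1`, with the
  gain `12 r log p / ((p-1)·[SL₂(ℤ):Γ₁(N)])` per unit order of vanishing (level one, `p = 5`:
  `3 r log 5`, the route's capacity number) and no potential theory.

Theorems only, no definitions, no `sorry`, no named-fact hypothesis.
-/

set_option linter.dupNamespace false

noncomputable section

open scoped MatrixGroups

namespace Summit.Langlands.Langlands.Theorems.HilbertIntegralOverconvergentIsCongruence

/-- **Registered stub 1′ (`stub_sturmModPrime`) of line `Sketch-ideate-r1-k1`, DISCHARGED**: Sturm's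
congruence bound mod `p` for cusp forms on `Γ₁(N)` — a cusp form `f ∈ S_k(Γ₁(N))` with rational-integer
`q`-expansion coefficients `zₙ` such that `p ∣ zₙ` for all `n ≤ ⌊k·[SL₂(ℤ):Γ₁(N)]/12⌋` has `p ∣ zₙ` for
every `n`.  This is verbatim the tree's named fact
`Literature.NumberTheory.ModularForms.Sturm1987_congruenceBound_Gamma1_modPrime`, now PROVED there
(`Sturm1987_congruenceBound_Gamma1_modPrime_holds`). [cite: Sturm1987, Thm. 1] -/
theorem stub_sturmModPrime :
    ∀ (N : ℕ) [NeZero N] (p : ℕ), p.Prime → ¬ p ∣ N →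
      ∀ (k : ℤ) (f : CuspForm (CongruenceSubgroup.Gamma1 N) k) (z : ℕ → ℤ),
        (∀ n : ℕ, PowerSeries.coeff n (UpperHalfPlane.qExpansion 1 ⇑f) = (z n : ℂ)) →
        (∀ n : ℕ, n ≤ (k * ((CongruenceSubgroup.Gamma1 N).index : ℤ)).toNat / 12 → (p : ℤ) ∣ z n) →
        ∀ n : ℕ, (p : ℤ) ∣ z n :=
  Literature.NumberTheory.ModularForms.Sturm1987_congruenceBound_Gamma1_modPrime_holds

/-- **The `d = 1` Sturm–Schwarz `p`-adic lemma at the cusp, every level, UNCONDITIONAL** (verbatim the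
registered endpoint statement `SketchIdeateR1K1.SturmSchwarzShadowCuspQ` of line `Sketch-ideate-r1-k1`).
For `p ≥ 5` prime and `p ∤ N`: a Katz surrogate `g_n = Σ_i ι⁻¹ coeff_n (c_i · E_{p-1}^{-i})` on `Γ₁(N)`
(`c_i` the `q`-expansion of a form of weight `k + i(p-1)` on `Γ₁(N)`, `‖ι⁻¹ c_i‖ ≤ C p^{-ri}`, `r > 0`,
`C ≥ 0`) whose `q`-expansion vanishes to order `m` satisfies `‖g_m‖ ≤ C · p^{-r(M+1)}` whenever
`⌊(12 + k + M(p-1)) · [SL₂(ℤ):Γ₁(N)] / 12⌋ ≤ m`.  Sturm's congruence bound enters as the tree's theorem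
`Sturm1987_congruenceBound_Gamma1_modPrime_holds`. [folklore] -/
theorem sturmSchwarzShadowCusp :
    ∀ (p : ℕ) [Fact p.Prime] (hp : 5 ≤ p) (N : ℕ) [NeZero N], ¬ p ∣ N →
      ∀ (k : ℤ) (ι : PadicAlgCl p ≃+* ℂ) (r C : ℝ) (c : ℕ → PowerSeries ℂ), 0 < r → 0 ≤ C →
      (∀ i : ℕ, ∃ F : ModularForm (CongruenceSubgroup.Gamma1 N) (k + i * (p - 1 : ℕ)),
          c i = UpperHalfPlane.qExpansion 1 ⇑F) →
      (∀ i n : ℕ, ‖ι.symm (PowerSeries.coeff n (c i))‖ ≤ C * (p : ℝ) ^ (-(r * i))) →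
      ∀ (g : ℕ → PadicAlgCl p),
      (∀ n : ℕ, HasSum (fun i : ℕ ↦ ι.symm (PowerSeries.coeff n (c i *
          ((UpperHalfPlane.qExpansion 1 ⇑(ModularForm.E (show 3 ≤ p - 1 by omega)))⁻¹) ^ i)))
          (g n)) →
      ∀ (m M : ℕ), (∀ n < m, g n = 0) →
        ((12 + (k + M * (p - 1 : ℕ))) * ((CongruenceSubgroup.Gamma1 N).index : ℤ)).toNat / 12 ≤ m →
        ‖g m‖ ≤ C * (p : ℝ) ^ (-(r * (M + 1 : ℕ))) :=
  fun p _ hp N _ hpN k ι r C c hr hC hc hb g hg m M hvan hline ↦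
    sturmSchwarzShadowCusp_of_sturmModPrime_at p hp N
      (fun k' f z hz hdiv ↦ stub_sturmModPrime N p Fact.out hpN k' f z hz hdiv)
      k ι r C c hr hC hc hb g hg m M hvan hline

end Summit.Langlands.Langlands.Theorems.HilbertIntegralOverconvergentIsCongruence

end
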